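import Mathlib
import HarnessLib
import Summits.Ventures.LatticeQCDFlow.Exactness.PairWords
import Summits.Ventures.LatticeQCDFlow.Exactness.DoeblinUniqueness

/-!
# The SU(N) Cabibbo–Marinari heat-bath update of one link is Doeblin, uniformly ergodic, with the one-link Wilson law as its unique invariant law

HONEST FRAMING: exact (Metropolis-corrected) sampling algorithms for lattice gauge theory;
figures of merit are autocorrelation/cost numbers at stated couplings and volumes; no
continuum-physics claim.

Venture `LatticeQCDFlow` (cell pub-lqcd), topic `Exactness`, FANOUT row 9 (eng-latcore, the
engine `latflow.core`; `update_link` in `csrc/latcore_template.c` runs one Cabibbo–Marinari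
heat-bath hit per coordinate pair `(i, j)`, `i < j`, lexicographically).  NEW WORK of the cell
over Mathlib and row 9's earlier files; nothing is cited as a fact.  Printed counterparts, NAMED
ONLY: Diaconis–Shahshahani 1987 (subgroup algorithm); Meyn–Tweedie 1993 Thm 16.0.2 (Doeblin ⇒
uniform ergodicity); Cabibbo–Marinari 1982 (the update).  Part of the proof that the SU(N ≥ 3)
Cabibbo–Marinari heat bath is uniformly ergodic.

## What is proved (`n` a finite nonempty index type; `SU(N) = Matrix.specialUnitaryGroup n ℂ`)

* §4 **`cmLinkUpdate_minorised`** (DOEBLIN): for frames running through all pairs `i < j`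
  lexicographically or in reverse (`cycle` applies the head of the list last, so the engine's
  forward scan is the reversed word), `cmLinkUpdate frames c R g ≥ ε • Haar_{SU(N)}` from EVERY
  `g`, with one `ε = hitConst^{#frames} · c > 0`; `linkGibbs c R` (the normalised one-link Wilson
  law `Z⁻¹ e^{c Re tr(gR)} dHaar`), `cmLinkUpdate_invariant_linkGibbs`;
  **`cmLinkUpdate_uniformlyErgodic`**: `|μ₀Kᵗ(A) − π(A)| ≤ (1 − ε)ᵗ` for every initial law `μ₀`,
  every `t`, every set `A`; **`cmLinkUpdate_invariant_unique`** (the one-link Wilson law is the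
  only invariant probability law).
* §5 `exists_frame_pairOf`, `ne_of_mem_lexPairs`, **`exists_lexFrames`** — for `N ≥ 2` a frame list
  into `Fin 2 ⊕ Fin (N − 2)` with exactly the lexicographic pairs exists: the hypothesis is the
  engine's scan, not vacuous.

NOT CLAIMED: the lattice sweep over all links (next file); any useful RATE (the constant is qualitative); interleaved over-relaxation (exact by `CabibboMarinariOverrelax.lean`, composes by `minorised_comp_left`).
-/

namespace Summit.Ventures.LatticeQCDFlow.Exactness

open Matrix MeasureTheory WithLp Metric Complex ProbabilityTheory Measure Set
open scoped ENNReal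

variable {n : Type*} [Fintype n] [DecidableEq n]

/-! ## §4 Doeblin for the SU(N) heat-bath update of one link; uniform ergodicity -/

section Doeblin

variable [Nonempty n] [LinearOrder n] {m : Type*} [Fintype m] [DecidableEq m]

/-- **DOEBLIN for the Cabibbo–Marinari link update.**  If the frames run through all coordinate
pairs `i < j` lexicographically (the engine's reversed scan) or in the reverse order (its forward
scan: `cycle` applies the head of the list last), then from EVERY link value `g` the update
dominates `ε ×` the Haar probability of `SU(N)`, with one `ε > 0` depending on `c = β/N`, `R` and `N`. -/
theorem cmLinkUpdate_minorised (c : ℝ) (R : Matrix n n ℂ) (frames : List (n ≃ Fin 2 ⊕ m))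
    (hlex : frames.map pairOf = lexPairs (Finset.univ.sort (· ≤ ·) : List n) ∨
      frames.map pairOf = (lexPairs (Finset.univ.sort (· ≤ ·) : List n)).reverse) :
    ∃ ε : ℝ≥0∞, ε ≠ 0 ∧ ∀ g,
      ε • Literature.MathematicalPhysics.QuantumFieldTheory.haarProbability (Matrix.specialUnitaryGroup n ℂ) ≤
        cmLinkUpdate frames c R g := by
  obtain ⟨c₀, hc₀, hhaar⟩ := smul_haar_le_listConv_pairs (n := n) (ps := frames.map pairOf) hlex
  refine ⟨hitConst c R ^ frames.length * c₀, mul_ne_zero (pow_ne_zero _ (hitConst_ne_zero c R)) hc₀, fun g => ?_⟩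
  -- each hit dominates `ε ×` its kick
  have h2 : List.Forall₂ (fun κ Φ => ∀ a, hitConst c R • Φ a ≤ κ a)
      (frames.map fun e => cmHit e c R)
      (frames.map fun e => subgroupMove haarSU2 (blockEmbSU e) (measurable_blockEmbSU e)) :=
    List.forall₂_map_left_iff.2 (List.forall₂_map_right_iff.2 (List.forall₂_same.2 fun e _ a => by
      rw [subgroupMove_apply]
      exact hitConst_smul_kick_le_cmHit e c R a))
  have hcyc := cycle_minorised h2 g
  rw [List.length_map, cycle_kicks_apply (fun e : n ≃ Fin 2 ⊕ m => blockEmbSU e)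
    (fun e => measurable_blockEmbSU e) g frames] at hcyc
  -- the kick laws are the pair laws of the lexicographic word
  have hfun : ((fun e : n ≃ Fin 2 ⊕ m => haarSU2.map (blockEmbSU e))) =
      (fun p : n × n => pairLaw' p.1 p.2) ∘ pairOf := by
    funext e; exact map_blockEmbSU_eq_pairLaw' e
  rw [hfun, ← List.map_map] at hcyc
  have h3 := Measure.map_mono hhaar (measurable_mul_const g)
  rw [Measure.map_smul, map_mul_right_eq_self] at h3
  calc (hitConst c R ^ frames.length * c₀) •
        Literature.MathematicalPhysics.QuantumFieldTheory.haarProbability (Matrix.specialUnitaryGroup n ℂ)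
      = hitConst c R ^ frames.length • (c₀ •
        Literature.MathematicalPhysics.QuantumFieldTheory.haarProbability (Matrix.specialUnitaryGroup n ℂ)) := by
          rw [smul_smul]
    _ ≤ hitConst c R ^ frames.length •
        (listConv ((frames.map pairOf).map fun p => pairLaw' p.1 p.2)).map (fun x => x * g) :=
          measure_smul_le_smul_of_le h3 _
    _ ≤ cmLinkUpdate frames c R g := hcyc

/-- The normalised one-link Wilson law `Z⁻¹ e^{c Re tr (g R)} dHaar(g)`. -/
noncomputable def linkGibbs (c : ℝ) (R : Matrix n n ℂ) : Measure (Matrix.specialUnitaryGroup n ℂ) :=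
  (((Literature.MathematicalPhysics.QuantumFieldTheory.haarProbability (Matrix.specialUnitaryGroup n ℂ)).withDensity
      (linkWeight c R)) Set.univ)⁻¹ •
    (Literature.MathematicalPhysics.QuantumFieldTheory.haarProbability (Matrix.specialUnitaryGroup n ℂ)).withDensity
      (linkWeight c R)

omit [Nonempty n] [LinearOrder n] in
/-- It is a probability measure. -/
instance isProbabilityMeasure_linkGibbs (c : ℝ) (R : Matrix n n ℂ) : IsProbabilityMeasure (linkGibbs c R) := by
  have h0 : ((Literature.MathematicalPhysics.QuantumFieldTheory.haarProbability (Matrix.specialUnitaryGroup n ℂ)).withDensity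
      (linkWeight c R)) Set.univ ≠ 0 := by
    rw [withDensity_apply _ MeasurableSet.univ, Measure.restrict_univ]
    refine ne_of_gt (lt_of_lt_of_le ?_ (lintegral_mono fun g => le_linkWeight c R g))
    rw [lintegral_const, measure_univ, mul_one]
    exact ENNReal.ofReal_pos.2 (Real.exp_pos _)
  refine ⟨?_⟩
  rw [linkGibbs, Measure.smul_apply, smul_eq_mul, ENNReal.inv_mul_cancel h0 (measure_ne_top _ _)]

omit [Nonempty n] [LinearOrder n] in
/-- The link update leaves it invariant (`CabibboMarinariSweep.lean`). -/
theorem cmLinkUpdate_invariant_linkGibbs (frames : List (n ≃ Fin 2 ⊕ m)) (c : ℝ) (R : Matrix n n ℂ) :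
    Kernel.Invariant (cmLinkUpdate frames c R) (linkGibbs c R) :=
  invariant_smul (cmLinkUpdate_invariant frames c R) _

/-- **The SU(N) heat-bath update of one link is uniformly ergodic**: for the lexicographic (or
reversed) scan over all coordinate pairs, from EVERY initial law `μ₀`, for every `t` and every set
`A`, `|μ₀Kᵗ(A) − π(A)| ≤ (1 − ε)ᵗ` with `π` the one-link Wilson law and `ε > 0` as in
`cmLinkUpdate_minorised`; in particular `π` is its unique invariant probability law. -/
theorem cmLinkUpdate_uniformlyErgodic (c : ℝ) (R : Matrix n n ℂ) (frames : List (n ≃ Fin 2 ⊕ m))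
    (hlex : frames.map pairOf = lexPairs (Finset.univ.sort (· ≤ ·) : List n) ∨
      frames.map pairOf = (lexPairs (Finset.univ.sort (· ≤ ·) : List n)).reverse) :
    ∃ ε : ℝ, 0 < ε ∧ ∀ (μ₀ : Measure (Matrix.specialUnitaryGroup n ℂ)) [IsProbabilityMeasure μ₀] (t : ℕ)
      (A : Set (Matrix.specialUnitaryGroup n ℂ)),
      |((fun ν : Measure (Matrix.specialUnitaryGroup n ℂ) => ν.bind (cmLinkUpdate frames c R))^[t] μ₀).real A
        - (linkGibbs c R).real A| ≤ (1 - ε) ^ t := by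
  obtain ⟨ε, hε, hmin⟩ := cmLinkUpdate_minorised c R frames hlex
  obtain ⟨g⟩ : Nonempty (Matrix.specialUnitaryGroup n ℂ) := ⟨1⟩
  have hε1 : ε ≤ 1 := by
    have h1 := Measure.le_iff'.1 (hmin g) Set.univ
    rwa [Measure.smul_apply, smul_eq_mul, measure_univ, measure_univ, mul_one] at h1
  have hεtop : ε ≠ ∞ := ne_top_of_le_ne_top ENNReal.one_ne_top hε1
  refine ⟨ε.toReal, ENNReal.toReal_pos hε hεtop, fun μ₀ _ t A => ?_⟩
  exact uniformlyErgodic_of_minorised hmin (cmLinkUpdate_invariant_linkGibbs frames c R) μ₀ t A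

/-- **Uniqueness of the invariant law** of the one-link SU(N) heat-bath update. -/
theorem cmLinkUpdate_invariant_unique (c : ℝ) (R : Matrix n n ℂ) (frames : List (n ≃ Fin 2 ⊕ m))
    (hlex : frames.map pairOf = lexPairs (Finset.univ.sort (· ≤ ·) : List n) ∨
      frames.map pairOf = (lexPairs (Finset.univ.sort (· ≤ ·) : List n)).reverse)
    (π' : Measure (Matrix.specialUnitaryGroup n ℂ)) [IsProbabilityMeasure π']
    (hπ' : Kernel.Invariant (cmLinkUpdate frames c R) π') : π' = linkGibbs c R := by
  obtain ⟨ε, hε, hmin⟩ := cmLinkUpdate_minorised c R frames hlex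
  exact invariant_unique_of_minorised hmin (pos_iff_ne_zero.2 hε) (cmLinkUpdate_invariant_linkGibbs frames c R) hπ'

end Doeblin

/-! ## §5 The engine's frame list exists: the hypothesis of §4 is the engine's scan, not vacuous -/

section Engine

variable [LinearOrder n]

omit [LinearOrder n] in
/-- For every ordered pair of distinct coordinates there is a frame into `Fin 2 ⊕ Fin (N − 2)` with
that pair (`pairFrame` followed by an enumeration of the remaining coordinates). -/
theorem exists_frame_pairOf (h2 : 2 ≤ Fintype.card n) {a b : n} (hab : a ≠ b) :
    ∃ e : n ≃ Fin 2 ⊕ Fin (Fintype.card n - 2), pairOf e = (a, b) := by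
  have hcard : Fintype.card {x : n // x ≠ a ∧ x ≠ b} = Fintype.card n - 2 := by
    have h := Fintype.card_congr (pairFrame a b hab)
    rw [Fintype.card_sum, Fintype.card_fin] at h
    omega
  let κ : {x : n // x ≠ a ∧ x ≠ b} ≃ Fin (Fintype.card n - 2) := Fintype.equivFinOfCardEq hcard
  refine ⟨(pairFrame a b hab).trans (Equiv.sumCongr (Equiv.refl (Fin 2)) κ), ?_⟩
  rw [pairOf, Prod.mk.injEq, Equiv.symm_apply_eq, Equiv.symm_apply_eq]
  exact ⟨by simp, by simp⟩

omit [Fintype n] [DecidableEq n] [LinearOrder n] in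
/-- The lexicographic pairs of a list of distinct coordinates are off-diagonal. -/
theorem ne_of_mem_lexPairs : ∀ {L : List n}, L.Nodup → ∀ p ∈ lexPairs L, p.1 ≠ p.2
  | [], _, p, hp => by simp [lexPairs] at hp
  | a :: l, hnd, p, hp => by
      rw [lexPairs, List.mem_append, List.mem_map] at hp
      rcases hp with ⟨j, hj, rfl⟩ | hp
      · intro h
        change a = j at h
        exact (List.nodup_cons.1 hnd).1 (h ▸ hj)
      · exact ne_of_mem_lexPairs (List.nodup_cons.1 hnd).2 p hp

/-- **The engine's scan**: for `N ≥ 2` there is a list of frames into `Fin 2 ⊕ Fin (N − 2)` running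
through all coordinate pairs `i < j` in lexicographic order (and its reverse is the forward scan),
so `cmLinkUpdate_minorised` / `cmLinkUpdate_uniformlyErgodic` apply to the engine's `update_link`. -/
theorem exists_lexFrames (h2 : 2 ≤ Fintype.card n) :
    ∃ frames : List (n ≃ Fin 2 ⊕ Fin (Fintype.card n - 2)),
      frames.map pairOf = lexPairs (Finset.univ.sort (· ≤ ·) : List n) := by
  classical
  have hall : ∀ p ∈ lexPairs (Finset.univ.sort (· ≤ ·) : List n),
      ∃ e : n ≃ Fin 2 ⊕ Fin (Fintype.card n - 2), pairOf e = p := fun p hp => by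
    obtain ⟨e, he⟩ := exists_frame_pairOf h2 (ne_of_mem_lexPairs (Finset.sort_nodup _ _) p hp)
    exact ⟨e, he⟩
  -- choose framewise
  suffices h : ∀ (ps : List (n × n)), (∀ p ∈ ps, ∃ e : n ≃ Fin 2 ⊕ Fin (Fintype.card n - 2), pairOf e = p) →
      ∃ frames : List (n ≃ Fin 2 ⊕ Fin (Fintype.card n - 2)), frames.map pairOf = ps from h _ hall
  intro ps
  induction ps with
  | nil => exact fun _ => ⟨[], rfl⟩
  | cons p ps ih =>
      intro h
      obtain ⟨e, he⟩ := h p (by simp)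
      obtain ⟨fs, hfs⟩ := ih fun q hq => h q (by simp [hq])
      exact ⟨e :: fs, by rw [List.map_cons, he, hfs]⟩

end Engine

end Summit.Ventures.LatticeQCDFlow.Exactness
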